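import Summits.Ventures.PercRepro.RankLevelSetLevelSevenRowSixtyEight
import Summits.Ventures.PercRepro.RankLevelSetCoreSevenOfFormS34
import Summits.Ventures.PercRepro.S1TriangleCountSharp
import Summits.Ventures.PercRepro.RankLevelSetLevelSevenRowSixtySevenSForm
import Summits.Ventures.PercRepro.RankLevelSetLevelSevenRowSixtySevenLarge

/-!
# PercRepro — THE ROW `67` OF LEVEL `7`: C-025 AT `q = 7` FOR EVERY FINITE MATROID AND EVERY `p ≥ 67` (p8, gen 19; a feeder
for S4 — the top of the `q = 7` window, from `68`; the first row on THE SHARP TRIANGLE COUNT)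

Level `7` at rank `67` by the per-rank wrapper `rls_succ_large_at 6 7 67` (p8 g0, S3SixWindow): level `6` at `66`
(`c025_six_all`) and the `e`-free core at `(67, d)` for every `d ≥ 8` — the cells `8 ≤ d ≤ 92` by their numeric forms ON THE
GIANT-EXACT COUNT WITH LEMMA T5 AND THE SHARP TRIANGLE COUNT (`quart_form67s`, RankLevelSetLevelSevenRowSixtySevenSForm: the
`N`-side `C(n, 7) + σ_m·Π_E″ + 2^{min 79 (7+d)}` with `s₃ ≤ C(d, 2) + 1` — the cells `(67, 14 … 16)` FAIL with LEMMA T's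
`s₃ ≤ d(d+1)/2`, `N`-side `1.002 … 1.008`, and close here at `≤ 0.95`) through `c025_core_seven_of_form_s34`
(RankLevelSetCoreSevenOfFormS34) with `hs3` from `S1.two_mul_ncard_triangles_le_sharp` (S1TriangleCountSharp) and `hs4` from
LEMMA T4 (`S1.three_mul_ncard_four_circuits_le`), the coranks `d ≥ 93` by the large-corank inequality at `(67, n ≥ 160)`
(`largeSeven_all67`) through `c025_core_seven_large_of_ineq` (RankLevelSetCoreSevenOfForm). The rows `≥ 68` are
`c025_seven_large_sixty_eight`.
* **`c025_core_seven_at_sixty_seven`** — the `e`-free core at rank `67`, every corank `d ≥ 8`;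
* **`c025_seven_at_sixty_seven`** — level `7` at rank `67`, every finite matroid;
* **`c025_seven_large_sixty_seven`** — level `7` for every `p ≥ 67`; **`c025_seven_sixty_seven`** the same in the `C025` body.
Axioms: standard.
-/

open scoped Matroid

namespace PercRepro

namespace ThmN

variable {α : Type}

/-- **The `e`-free core of level `7` at rank `67`, every corank `d ≥ 8`**: the numeric forms of the cells `(67, 8 … 92)` on the
giant-exact count with Lemma T5 and the sharp triangle count, and the large-corank inequality at `(67, n ≥ 160)`. -/
theorem c025_core_seven_at_sixty_seven (M : Matroid α) [M.Finite] (d : ℕ) (hd8 : 8 ≤ d) (hR : M.eRank = (67 : ℕ∞))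
    (hn : M.E.ncard = 67 + d) (hfree : EFree M) : RLS M 67 7 := by
  rcases Nat.lt_or_ge d 93 with h | h
  · -- the circuit bounds: the sharp triangle count and Lemma T4
    have hd : M.E.encard = M.eRank + d := by
      rw [hR, ← M.ground_finite.cast_ncard_eq, hn]
      push_cast
      ring
    have hL0 : ∀ e ∈ M.E, ¬ M.IsLoop e := not_isLoop_of_free M hfree
    have hs : ∀ e ∈ M.E, ∀ f ∈ M.E, e ≠ f → M.eRk {e, f} = 2 := by
      intro e he f hf hef
      have h2 : (2 : ℕ∞) ≤ M.eRk {e, f} :=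
        two_le_eRk_of_two_le_ncard_of_free M hfree (Set.pair_subset he hf) (by rw [Set.ncard_pair hef])
      have h3 : M.eRk {e, f} ≤ 2 := by
        have := M.eRk_le_encard {e, f}
        rwa [Set.encard_pair hef] at this
      exact le_antisymm h3 h2
    have hC1 : ∀ L ⊆ M.E, M.eRk L = 2 → L.ncard ≤ 3 :=
      fun L hL hr => ncard_le_three_of_eRk_two M hs hfree hL hr
    have hC1' : ∀ L ⊆ M.E, M.eRk L ≤ 2 → L.ncard ≤ 3 := by
      intro L hL' hr
      have := ncard_add_one_le_two_pow_of_eRk_le M hL0 hfree 2 L hL' hr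
      omega
    have hC2 : ∀ P ⊆ M.E, M.eRk P ≤ 3 → P.ncard ≤ 6 :=
      fun P hP hr => ncard_le_six_of_eRk_le_three_of_free M hfree hP hr
    have hs3 : {C | M.IsCircuit C ∧ C.ncard = 3}.ncard ≤ d * (d - 1) / 2 + 1 := by
      have hT : 2 * {C | M.IsCircuit C ∧ C.ncard = 3}.ncard ≤ d * (d - 1) + 2 :=
        S1.two_mul_ncard_triangles_le_sharp M hC1 hd
      omega
    have hs4 : {C | M.IsCircuit C ∧ C.ncard = 4}.ncard ≤ d * (d + 1) * (d + 2) / 3 := by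
      have hT4 : 3 * {C : Set α | M.IsCircuit C ∧ C.ncard = 4}.ncard ≤ d * (d + 1) * (d + 2) :=
        S1.three_mul_ncard_four_circuits_le M hC1' hC2 hd
      omega
    exact c025_core_seven_of_form_s34 M 67 d (d * (d - 1) / 2 + 1) (d * (d + 1) * (d + 2) / 3) hd8 hR hn hfree hs3 hs4
      (quart_form67s d hd8 (by omega))
  · exact c025_core_seven_large_of_ineq M 67 hR (largeSeven_all67 M.E.ncard (by omega)) hfree

/-- **Level `7` at rank `67`, every finite matroid**: `rls_succ_large_at 6 7 67` on level `6` at `66` (`c025_six_all`), the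
coranks `≤ 7` (`U = ∅` or Theorem M) and the core at `67`. -/
theorem c025_seven_at_sixty_seven (M : Matroid α) [M.Finite] : RLS M 67 7 := by
  refine rls_succ_large_at (α := α) 6 7 67 (by norm_num) (fun M _ => c025_six_all M 66 (by norm_num)) ?_ ?_ M
  · -- corank `≤ 7`: `U = ∅` or Theorem M
    intro M _ hn
    rcases Nat.lt_or_ge M.E.ncard (67 + 7) with h | h
    · exact RLS_of_ncard_lt M h
    · exact RLS_of_ncard_eq M (by omega)
  · -- the core at corank `≥ 8`
    intro M _ hR hbig hfree
    exact c025_core_seven_at_sixty_seven M (M.E.ncard - 67) (by omega) hR (by omega) hfree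

/-- **THEOREM C₇ AT `67`, UNCONDITIONAL OVER THE TREE**: every finite matroid satisfies C-025 at level `7` for every
`p ≥ 67` — the row `67` by `c025_seven_at_sixty_seven`, the rows `≥ 68` by `c025_seven_large_sixty_eight`. -/
theorem c025_seven_large_sixty_seven (M : Matroid α) [M.Finite] (p : ℕ) (hp : 67 ≤ p) : RLS M p 7 := by
  rcases Nat.lt_or_ge p 68 with h | h
  · have h67 : p = 67 := by omega
    subst h67
    exact c025_seven_at_sixty_seven M
  · exact c025_seven_large_sixty_eight M p h

/-- The same in the literal `C025` body: `phiK p 7 · #U(p, 7) ≤ #Y(p, 7)` for every finite matroid and every `p ≥ 67`. -/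
theorem c025_seven_sixty_seven (M : Matroid α) [M.Finite] (p : ℕ) (hp : 67 ≤ p) :
    phiK p 7 * ({A : Set α | A ⊆ M.E ∧ M.eRk A = (p : ℕ∞) ∧ M.eRk (M.E \ A) = (7 : ℕ∞)}.ncard : ℚ) ≤
      ({A : Set α | A ⊆ M.E ∧ (7 : ℕ∞) < M.eRk A ∧ M.eRk A < (p : ℕ∞)}.ncard : ℚ) :=
  c025_seven_large_sixty_seven M p hp

end ThmN

end PercRepro
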